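import Summits.ResolutionOfSingularities.ResolutionOfSingularities.Theorems.LossEntryW14
import HarnessLib
/-!
# LossEntryW15 (= lens-3 g29 slice 9, part 1) — walk plumbing of the loss→entry law — the β-type chain step: THE ROW LEMMA

decomp-res-lens-3, gen 29 (NODE-g29 §3bis (N6)–(N7)).  TOOL at 0.  Imports `Theorems.LossEntryW14` (landing part 14 = slice 8).

§26 — THE ROW LEMMA (one-variable kernel): `exists_coeff_taylor_ne_zero` (`R ≠ 0`, `X^a ∣ R`, `deg R ≤ a+b`, `g ≠ 0` ⇒
`∃ k ≤ b, (taylor g R).coeff k ≠ 0`), the row polynomial `rowPoly a b c G c₀ A = Σ_{D_c = c₀, D_a+D_b = A} c_D X^{D_a}`,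
`shearExp_eq_iff`, `coeff_shear_eq_taylor_rowPoly` (the coefficients of `σ_{a,b,g} G` on a row ARE the Taylor coefficients of the row
polynomial), `X_pow_dvd_rowPoly`, `natDegree_rowPoly_le`, `rowPoly_ne_zero`, and **`exists_mem_support_shear_row`**: the translation
`u_a ↦ u_a + g u_b` (`g ≠ 0`) leaves on the row of a row-leftmost `L ∈ supp G` a monomial `E` with `E_a ≤ L_b`.
(§27–§28, the β-STEP ORDINATE LAW, follow in `LossEntryW16`.)
-/

open MvPolynomial Finset
open Literature.AlgebraicGeometry.Resolution
open Literature.AlgebraicGeometry.Resolution.Hauser2010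
open Literature.AlgebraicGeometry.Resolution.PointBlowup
open Summit.ResolutionOfSingularities.ResolutionOfSingularities.Theorems.TightDefectClasses
open Summit.ResolutionOfSingularities.ResolutionOfSingularities.Theorems.TightDefectStrongWalks
open Summit.ResolutionOfSingularities.ResolutionOfSingularities.Theorems.ItineraryCutClasses
open Summit.ResolutionOfSingularities.ResolutionOfSingularities.Theorems.BoundaryLedger
open Summit.ResolutionOfSingularities.ResolutionOfSingularities.Theorems.ProximityCut
open Summit.ResolutionOfSingularities.ResolutionOfSingularities.Theorems.LossExitCone
open Summit.ResolutionOfSingularities.ResolutionOfSingularities.Theorems.LossPolygon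

/-! ## §26 THE ROW LEMMA (one-variable kernel of the β-step survival argument, NODE-g29 §3bis (N7)) -/

namespace Summit.ResolutionOfSingularities.ResolutionOfSingularities.Theorems.LossPolygon

open scoped Polynomial

/-- **ROW LEMMA, polynomial form (PROVED).**  If `R ≠ 0`, `X^a ∣ R`, `deg R ≤ a + b` and `g ≠ 0`, then the Taylor expansion of `R`
at `g` has a non-zero coefficient in degree `≤ b`: `∃ k ≤ b, (taylor g R).coeff k ≠ 0`.  (Else `(X−g)^{b+1} ∣ R` and `X^a ∣ R` are
coprime divisors of total degree `a+b+1 > deg R`.)  Applied to the row polynomial `Σ_D c_D X^{D_a}` of a one-wall equation along a row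
`{D_c = c₀, D_a + D_b = A}` (leftmost element `L`, `a = L_a`, `b = L_b`), it says: the translation `u_a ↦ u_a + g u_b` leaves on that
row a monomial with `a`-exponent `k ≤ L_b`, i.e. an entry point of ordinate `≤ y_L`. [elementary; new] -/
theorem exists_coeff_taylor_ne_zero {K : Type} [Field K] {R : K[X]} (hR : R ≠ 0) {a b : ℕ} (ha : Polynomial.X ^ a ∣ R)
    (hdeg : R.natDegree ≤ a + b) {g : K} (hg : g ≠ 0) : ∃ k ≤ b, (Polynomial.taylor g R).coeff k ≠ 0 := by
  by_contra hcon
  push Not at hcon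
  have hT : Polynomial.X ^ (b + 1) ∣ Polynomial.taylor g R := by
    rw [Polynomial.X_pow_dvd_iff]
    intro d hd
    exact hcon d (by omega)
  obtain ⟨U, hU⟩ := hT
  have hRU : R = (Polynomial.X - Polynomial.C g) ^ (b + 1) * Polynomial.taylor (-g) U := by
    have h := congrArg (Polynomial.taylor (-g)) hU
    rw [Polynomial.taylor_taylor, neg_add_cancel, Polynomial.taylor_zero] at h
    rw [Polynomial.taylor_mul, Polynomial.taylor_pow, Polynomial.taylor_X, map_neg, ← sub_eq_add_neg] at h
    exact h
  have hdvd2 : (Polynomial.X - Polynomial.C g) ^ (b + 1) ∣ R := ⟨_, hRU⟩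
  have hcop : IsCoprime (Polynomial.X ^ a : K[X]) ((Polynomial.X - Polynomial.C g) ^ (b + 1)) := by
    have h0 : IsCoprime (Polynomial.X - Polynomial.C (0 : K)) (Polynomial.X - Polynomial.C g) :=
      Polynomial.isCoprime_X_sub_C_of_isUnit_sub (by rw [zero_sub, IsUnit.neg_iff]; exact isUnit_iff_ne_zero.mpr hg)
    rw [map_zero, sub_zero] at h0
    exact h0.pow
  have hprod : Polynomial.X ^ a * (Polynomial.X - Polynomial.C g) ^ (b + 1) ∣ R := hcop.mul_dvd ha hdvd2
  have hdegle := Polynomial.natDegree_le_of_dvd hprod hR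
  rw [Polynomial.natDegree_mul (pow_ne_zero _ Polynomial.X_ne_zero) (pow_ne_zero _ (Polynomial.X_sub_C_ne_zero g)),
    Polynomial.natDegree_pow, Polynomial.natDegree_X, Polynomial.natDegree_pow, Polynomial.natDegree_X_sub_C] at hdegle
  omega

end Summit.ResolutionOfSingularities.ResolutionOfSingularities.Theorems.LossPolygon

namespace Summit.ResolutionOfSingularities.ResolutionOfSingularities.Theorems.LossPolygon

open MvPolynomial ConeCut
open scoped Polynomial

variable {K : Type} [Field K]

section Row

variable {a b c : Fin 3}

/-- The ROW POLYNOMIAL of `G` along the row `{D_c = c₀, D_a + D_b = A}`, in the variable «`u_a`-exponent»: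
`Σ_{D ∈ row} (coeff_D G)·X^{D_a}`. [new object] -/
noncomputable def rowPoly (a b c : Fin 3) (G : MvPolynomial (Fin 3) K) (c₀ A : ℕ) : K[X] :=
  ∑ D ∈ G.support with (D c = c₀ ∧ D a + D b = A), Polynomial.monomial (D a) (coeff D G)

/-- `shearExp` for the shear `σ_{a,b,g}` (`u_a ↦ u_a + g u_b`, letters `(b, c ; a)`): `E = shearExp b c a D n` iff
`E_b = D_b + n`, `E_c = D_c`, `E_a = D_a − n`. [new; elementary] -/
theorem shearExp_eq_iff (hab : a ≠ b) (hac : a ≠ c) (hbc : b ≠ c) (D E : Fin 3 →₀ ℕ) (n : ℕ) :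
    shearExp b c a D n = E ↔ D b + n = E b ∧ D c = E c ∧ D a - n = E a := by
  constructor
  · rintro rfl
    exact ⟨(shearExp_apply_fst hbc (Ne.symm hab) D n).symm, (shearExp_apply_snd hbc (Ne.symm hac) D n).symm,
      (shearExp_apply_thd (Ne.symm hab) (Ne.symm hac) D n).symm⟩
  · rintro ⟨h1, h2, h3⟩
    ext w
    rcases fin3_eq_or a b c w hab hac hbc with rfl | rfl | rfl
    · rw [shearExp_apply_thd (Ne.symm hab) (Ne.symm hac), h3]
    · rw [shearExp_apply_fst hbc (Ne.symm hab), h1]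
    · rw [shearExp_apply_snd hbc (Ne.symm hac), h2]

/-- **COEFFICIENTS OF `σ_{a,b,g} G` ALONG A ROW ARE THE TAYLOR COEFFICIENTS OF THE ROW POLYNOMIAL (PROVED):** for `E` on the row
`{E_c = c₀, E_a + E_b = A}`, `coeff_E(σ_{a,b,g} G) = (taylor g (rowPoly a b c G c₀ A)).coeff (E a)` (`= Σ_D c_D·C(D_a, E_a)·g^{D_a − E_a}`,
the Hasse derivatives at `g`). [new] -/
theorem coeff_shear_eq_taylor_rowPoly (hab : a ≠ b) (hac : a ≠ c) (hbc : b ≠ c) (g : K) (G : MvPolynomial (Fin 3) K)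
    (E : Fin 3 →₀ ℕ) :
    coeff E (shear a b g G) = (Polynomial.taylor g (rowPoly a b c G (E c) (E a + E b))).coeff (E a) := by
  classical
  rw [coeff_shear hbc (Ne.symm hab) (Ne.symm hac) g G E, rowPoly, map_sum, Polynomial.finsetSum_coeff, Finset.sum_filter]
  refine Finset.sum_congr rfl fun D _ => ?_
  have hT : (Polynomial.taylor g (Polynomial.monomial (D a) (coeff D G))).coeff (E a) =
      coeff D G * g ^ (D a - E a) * ((D a).choose (E a) : K) := by
    rw [Polynomial.taylor_monomial, Polynomial.coeff_C_mul, Polynomial.coeff_X_add_C_pow, mul_assoc]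
  by_cases hrow : D c = E c ∧ D a + D b = E a + E b
  · rw [if_pos hrow, hT]
    by_cases hle : E a ≤ D a
    · rw [Finset.sum_eq_single (D a - E a)]
      · rw [if_pos ((shearExp_eq_iff hab hac hbc D E _).mpr ⟨by omega, hrow.1, by omega⟩), Nat.choose_symm hle]
      · intro n _ hn
        rw [if_neg]
        intro h
        rw [shearExp_eq_iff hab hac hbc] at h
        omega
      · intro h
        exact absurd (Finset.mem_range.mpr (by omega)) h
    · rw [Nat.choose_eq_zero_of_lt (by omega), Nat.cast_zero, mul_zero]
      refine Finset.sum_eq_zero fun n hn => if_neg fun h => ?_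
      rw [shearExp_eq_iff hab hac hbc] at h
      omega
  · rw [if_neg hrow]
    refine Finset.sum_eq_zero fun n hn => if_neg fun h => hrow ?_
    rw [shearExp_eq_iff hab hac hbc] at h
    have := Finset.mem_range.mp hn
    omega

/-- `X^{a_L} ∣ rowPoly` when every row element has `a`-exponent `≥ a_L` (e.g. the wall `u_a^M`, or the leftmost row element). [new; elementary] -/
theorem X_pow_dvd_rowPoly (G : MvPolynomial (Fin 3) K) (c₀ A : ℕ) {aL : ℕ}
    (h : ∀ D ∈ G.support, D c = c₀ → D a + D b = A → aL ≤ D a) :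
    (Polynomial.X : K[X]) ^ aL ∣ rowPoly a b c G c₀ A := by
  classical
  unfold rowPoly
  refine Finset.dvd_sum fun D hD => ?_
  rw [Finset.mem_filter] at hD
  obtain ⟨m, hm⟩ := Nat.exists_eq_add_of_le (h D hD.1 hD.2.1 hD.2.2)
  rw [hm]
  exact ⟨Polynomial.monomial m (coeff D G), by rw [Polynomial.X_pow_mul_monomial, add_comm]⟩

/-- `deg rowPoly ≤ A` (the `a`-exponent on the row is at most `A = D_a + D_b`). [new; elementary] -/
theorem natDegree_rowPoly_le (G : MvPolynomial (Fin 3) K) (c₀ A : ℕ) : (rowPoly a b c G c₀ A).natDegree ≤ A := by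
  classical
  unfold rowPoly
  refine Polynomial.natDegree_sum_le_of_forall_le _ _ fun D hD => ?_
  rw [Finset.mem_filter] at hD
  exact (Polynomial.natDegree_monomial_le _).trans (by omega)

/-- The row polynomial is non-zero as soon as the row meets the support. [new; elementary] -/
theorem rowPoly_ne_zero {G : MvPolynomial (Fin 3) K} {c₀ A : ℕ} {L : Fin 3 →₀ ℕ} (hL : L ∈ G.support) (hLc : L c = c₀)
    (hLab : L a + L b = A) (hab : a ≠ b) (hac : a ≠ c) (hbc : b ≠ c) : rowPoly a b c G c₀ A ≠ 0 := by
  classical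
  intro h0
  have hcoef : (rowPoly a b c G c₀ A).coeff (L a) = coeff L G := by
    unfold rowPoly
    rw [Polynomial.finsetSum_coeff, Finset.sum_eq_single L]
    · exact Polynomial.coeff_monomial_same _ _
    · intro D hD hDL
      rw [Finset.mem_filter] at hD
      rw [Polynomial.coeff_monomial, if_neg]
      intro hDa
      apply hDL
      ext w
      rcases fin3_eq_or a b c w hab hac hbc with rfl | rfl | rfl
      · exact hDa
      · omega
      · rw [hD.2.1, hLc]
    · intro hLr
      exact absurd (Finset.mem_filter.mpr ⟨hL, hLc, hLab⟩) hLr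
  rw [h0, Polynomial.coeff_zero] at hcoef
  exact (mem_support_iff.mp hL) hcoef.symm

/-- **THE ROW LEMMA FOR THE SHEAR `σ_{a,b,g}` (PROVED):** if `g ≠ 0` and `L ∈ supp G` is an element of its row with every row element
having `a`-exponent `≥ L_a` (the leftmost one), then `σ_{a,b,g} G` has, ON THE SAME ROW, a monomial `E` with `E_a ≤ L_b`
(before cleaning).  This is the survival mechanism of the β-type chain step: the entry abscissa is a row invariant and the entry
ordinate of `E` is `E_a/d ≤ L_b/d = y_L`. [NODE-g29 §3bis (N7); new] -/
theorem exists_mem_support_shear_row (hab : a ≠ b) (hac : a ≠ c) (hbc : b ≠ c) {g : K} (hg : g ≠ 0)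
    {G : MvPolynomial (Fin 3) K} {L : Fin 3 →₀ ℕ} (hL : L ∈ G.support)
    (hleft : ∀ D ∈ G.support, D c = L c → D a + D b = L a + L b → L a ≤ D a) :
    ∃ E ∈ (shear a b g G).support, E c = L c ∧ E a + E b = L a + L b ∧ E a ≤ L b := by
  classical
  obtain ⟨k, hk, hne⟩ := exists_coeff_taylor_ne_zero (a := L a) (b := L b) (rowPoly_ne_zero hL rfl rfl hab hac hbc)
    (X_pow_dvd_rowPoly G (L c) (L a + L b) hleft) (natDegree_rowPoly_le G (L c) (L a + L b)) hg
  have hkA : k ≤ L a + L b := by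
    by_contra hlt
    apply hne
    refine Polynomial.coeff_eq_zero_of_natDegree_lt (lt_of_le_of_lt ?_ (not_le.mp hlt))
    refine (Polynomial.natDegree_taylor _ _).le.trans ?_
    exact natDegree_rowPoly_le G _ _
  let E : Fin 3 →₀ ℕ := Finsupp.single a k + Finsupp.single b (L a + L b - k) + Finsupp.single c (L c)
  have hEa : E a = k := by simp [E, hab, hac]
  have hEb : E b = L a + L b - k := by simp [E, hab.symm, hbc]
  have hEc : E c = L c := by simp [E, hac.symm, hbc.symm]
  refine ⟨E, ?_, hEc, by omega, by omega⟩
  rw [mem_support_iff, coeff_shear_eq_taylor_rowPoly hab hac hbc, hEc, hEa, hEb, show k + (L a + L b - k) = L a + L b by omega]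
  exact hne

end Row

end Summit.ResolutionOfSingularities.ResolutionOfSingularities.Theorems.LossPolygon
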